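import Literature.NumberTheory.EllipticCurves.BhargavaShankarSievePhiMeasurableProofs
import Literature.NumberTheory.EllipticCurves.BinaryQuarticCongruenceAveragesProofs
import Literature.NumberTheory.EllipticCurves.BinaryQuarticOrbitWeightsIntegralProofs
import Literature.NumberTheory.EllipticCurves.BinaryQuarticFormsProofs
import Mathlib.Topology.Algebra.InfiniteSum.Basic
import HarnessLib

/-!
# The level-`n` weights of the upper sieve (Bhargava–Shankar, proof of Thm 2.21, upper bound):
# `GL₂(ℤ)`-invariance of the envelopes, the product weight modulo `N = ∏ p^{n}` and its density,
# and the local sieve weight `φ_p = 1_{sol} 1_{F_p^{inv}} / m_p`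

`Proofs` file (theorems only: no definitions, no named facts). Source: M. Bhargava, A. Shankar,
*Binary quartic forms having bounded invariants, and the boundedness of the average rank of
elliptic curves*, Ann. of Math. (2) 181 (2015) 191–242, §2.7 of the published version
(= `arXiv:1006.1002v3`), proof of Thm 2.21, the **upper bound**:

> "Let `φ_p`, `ψ_{p,n}`, `ψ'_{p,n}` … `ψ'_{p,n}(f) = sup φ_p` over the congruence class of `f`
> modulo `pⁿ` … For `Y > 0` let `ψ'^Y = ∏_{p<Y} ψ'_{p,⌊Y/p⌋}` [a function on `V_ℤ` defined by
> congruence conditions modulo `N = ∏_{p<Y} p^{⌊Y/p⌋}`] … then `φ ≤ ψ'^Y`, and it follows from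
> Theorem 2.12 that, for any fixed `Y`, `limsup_X N_φ(V^{(i)};X)/X^{5/6} ≤
> limsup_X N_{ψ'^Y}(V^{(i)};X)/X^{5/6} = lim_X N(V^{(i)};X)/X^{5/6} · ∏_{p<Y} ∫ ψ'_{p,⌊Y/p⌋}`",

applied (proof of Thm 3.19 = the sieve step of eq. (31) of `arXiv:1006.1002v2`) to the local
weights `φ_p(f) = 1/m_p(f)` for `f` `ℚ_p`-soluble with invariants in `2⁴F_p^{inv} × 2⁶F_p^{inv}`,
`0` otherwise. This file supplies every property of these weights that the upper bound uses,
for the congruence count of Thm 2.12 in the form of a `GL₂(ℤ)`-invariant weight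
`Ψ : (ℤ/Nℤ)⁵ → [0,1]` (tree: `Literature.Algebra.EuclideanLattices.abs_sum_weight_sub_density_mul_volume_le`,
`BinaryQuarticCongruenceAveragesProofs`):

* §1 (`V_{ℤ_p}`, any weight `φ` with values `≤ 1`): congruences modulo `pⁿ` are preserved by
  integral substitutions (`forall_pow_dvd_subst_sub_subst`), hence **the envelope
  `ψ'_n = sup_{C_n(·)} φ` inherits invariance under unimodular substitutions from `φ`**
  (`sSup_image_congr_subst_eq`).
* §2 the local sieve weight `φ_p` (written out, as in `BhargavaShankarSievePhiRegularityProofs`):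
  `0 ≤ φ_p ≤ 1` (tree: `sievePhi_nonneg_le_one`); **invariance under substitutions `δ` with `det(δ)² = 1`** (`ℚ_p`-solubility by
  `isSoluble_subst_iff`, the invariants by `I(δf) = det⁴ I`, `J(δf) = det⁶ J`, and
  `m_p(δf) = m_p(f)` by `weight_smul`, the twisted action of `δ` being `f ↦ f ∘ δ` when
  `det² = 1`); a.e. local constancy (acceptability, `eventually_sievePhi_eq` off the null set
  `Δ = 0`) and hence **`∫ ψ'_{p,n} → ∫ φ_p`** (`tendsto_integral_sSup_sievePhi`, dominated
  convergence from `BinaryQuarticCongruenceEnvelopesProofs`); and `φ_p(f ⊗ ℤ_p) = 1/m_p(f)` for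
  the locally soluble integral forms with the invariants of a curve `E_{A,B}` of the family.
* §3 (a finite family of primes `q_i`, level `n`, class functions `E_i` on `V_{ℤ_{q_i}}`
  represented on residues by `G_i`): the product weight `f ↦ ∏_i E_i(f ⊗ ℤ_{q_i})` on `V_ℤ` is
  the pull-back of `Ψ(r) = ∏_i G_i(r mod q_i^n)` on `(ℤ/Nℤ)⁵`, `N = ∏ q_i^n`
  (`prod_classFn_map_intCast_eq`); `Ψ` takes values in `[0,1]` and is `GL₂(ℤ)`-invariant when the
  `E_i` are invariant under unimodular substitutions (`prod_classFn_eq_of_gl2zEquiv`); and **its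
  density is the product of the local integrals**, `N⁻⁵ Σ_r Ψ(r) = ∏_i ∫ E_i dμ_{q_i}`
  (`density_prod_classFn_eq_prod_integral`) — "`lim N_{ψ'^Y}/N = ∏_{p<Y} ∫ψ'`".
* §4 the exchange of limits for the upper bound: if `∫ψ'_{p,n} → a_p` for each `p` and
  `∏_p a_p` converges to `A` (here by (27)), then for every `δ > 0` some finite set of primes and
  some level give `∏_{p ∈ P} ∫ψ'_{p,n} ≤ A + δ` (`exists_finset_prod_le_tprod_add`).

## References

* M. Bhargava, A. Shankar, Ann. of Math. (2) 181 (2015) 191–242, §2.7, proof of Thm 2.21 (upper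
  bound), §3.2 (`m_p`), proof of Thm 3.19 (the weights `φ_p`); published numbering.
  [cite: BhargavaShankarAnnals2015, §2.7 proof of Thm 2.21 (upper bound) and proof of Thm 3.19 (published numbering)]
-/

noncomputable section

open scoped Classical Topology
open Filter Set MeasureTheory Finset

namespace Literature.NumberTheory.EllipticCurves

namespace BinaryQuartic

/-! ## §1 Envelopes and unimodular substitutions on `V_{ℤ_p}` -/

section Local

variable {p : ℕ} [Fact p.Prime]

/-- Coefficients are additive. [folklore] -/
theorem coeffs_add_apply {R : Type*} [CommRing R] (f g : BinaryQuartic R) (i : Fin 5) :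
    (f + g).coeffs i = f.coeffs i + g.coeffs i := by
  fin_cases i <;> rfl

/-- Coefficients are homogeneous. [folklore] -/
theorem coeffs_smul_apply {R : Type*} [CommRing R] (c : R) (f : BinaryQuartic R) (i : Fin 5) :
    (c • f).coeffs i = c * f.coeffs i := by
  fin_cases i <;> rfl

/-- **Congruences modulo `pⁿ` are preserved by integral substitutions**: if `g ≡ f (mod pⁿ)`
coefficientwise then `g ∘ γ ≡ f ∘ γ (mod pⁿ)` for every `γ ∈ M₂(ℤ_p)` (write `g = f + pⁿ h`;
substitution is additive and `ℤ_p`-homogeneous). [folklore] -/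
theorem forall_pow_dvd_subst_sub_subst {n : ℕ} {f g : BinaryQuartic ℤ_[p]}
    (h : ∀ i, (p : ℤ_[p]) ^ n ∣ g.coeffs i - f.coeffs i) (γ : Matrix (Fin 2) (Fin 2) ℤ_[p]) :
    ∀ i, (p : ℤ_[p]) ^ n ∣ (g.subst γ).coeffs i - (f.subst γ).coeffs i := by
  choose c hc using h
  let h' : BinaryQuartic ℤ_[p] := ⟨c 0, c 1, c 2, c 3, c 4⟩
  have hh' : ∀ i, h'.coeffs i = c i := by
    intro i
    fin_cases i <;> rfl
  have hg : g = f + ((p : ℤ_[p]) ^ n) • h' := by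
    apply coeffs_injective
    funext i
    rw [coeffs_add_apply, coeffs_smul_apply, hh', ← hc i]
    ring
  intro i
  rw [hg, subst_add, smul_subst, coeffs_add_apply, coeffs_smul_apply]
  exact ⟨(h'.subst γ).coeffs i, by ring⟩

/-- One-sided transport of the envelope: if `γ'γ = 1` and `φ(h ∘ γ') = φ(h)` for all `h`, then
`sup_{C_n(f∘γ)} φ ≤ sup_{C_n(f)} φ` (`g ≡ f∘γ ⇒ g∘γ' ≡ f`). [folklore] -/
theorem sSup_image_congr_subst_le {φ : BinaryQuartic ℤ_[p] → ℝ} (h1 : ∀ f, φ f ≤ 1)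
    {γ γ' : Matrix (Fin 2) (Fin 2) ℤ_[p]} (hγ'γ : γ' * γ = 1) (hφ : ∀ h : BinaryQuartic ℤ_[p], φ (h.subst γ') = φ h)
    (n : ℕ) (f : BinaryQuartic ℤ_[p]) :
    sSup (φ '' {g : BinaryQuartic ℤ_[p] | ∀ i, (p : ℤ_[p]) ^ n ∣ g.coeffs i - (f.subst γ).coeffs i}) ≤
      sSup (φ '' {g : BinaryQuartic ℤ_[p] | ∀ i, (p : ℤ_[p]) ^ n ∣ g.coeffs i - f.coeffs i}) := by
  refine csSup_le (image_congr_nonempty φ n _) ?_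
  rintro _ ⟨g, hg, rfl⟩
  have hmem : ∀ i, (p : ℤ_[p]) ^ n ∣ (g.subst γ').coeffs i - f.coeffs i := by
    have := forall_pow_dvd_subst_sub_subst hg γ'
    rwa [← subst_mul, hγ'γ, subst_one] at this
  calc φ g = φ (g.subst γ') := (hφ g).symm
    _ ≤ _ := le_csSup (bddAbove_image_congr h1 n f) ⟨_, hmem, rfl⟩

/-- **The envelope `ψ'_n = sup_{C_n(·)} φ` is invariant under a unimodular substitution `γ`
whenever `φ` is invariant under `γ` and `γ⁻¹`**: for `γγ' = γ'γ = 1`,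
`sup_{C_n(f∘γ)} φ = sup_{C_n(f)} φ`. (Used for `γ ∈ GL₂(ℤ) ⊂ GL₂(ℤ_p)`: the level-`n` weights of
the sieve are `GL₂(ℤ)`-invariant, as Thm 2.12 requires.)
[cite: BhargavaShankarAnnals2015, §2.7, proof of Thm 2.21 (ψ'_{p,n}; published numbering)] -/
theorem sSup_image_congr_subst_eq {φ : BinaryQuartic ℤ_[p] → ℝ} (h1 : ∀ f, φ f ≤ 1)
    {γ γ' : Matrix (Fin 2) (Fin 2) ℤ_[p]} (hγγ' : γ * γ' = 1) (hγ'γ : γ' * γ = 1)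
    (hφ : ∀ h : BinaryQuartic ℤ_[p], φ (h.subst γ) = φ h) (hφ' : ∀ h : BinaryQuartic ℤ_[p], φ (h.subst γ') = φ h)
    (n : ℕ) (f : BinaryQuartic ℤ_[p]) :
    sSup (φ '' {g : BinaryQuartic ℤ_[p] | ∀ i, (p : ℤ_[p]) ^ n ∣ g.coeffs i - (f.subst γ).coeffs i}) =
      sSup (φ '' {g : BinaryQuartic ℤ_[p] | ∀ i, (p : ℤ_[p]) ^ n ∣ g.coeffs i - f.coeffs i}) := by
  refine le_antisymm (sSup_image_congr_subst_le h1 hγ'γ hφ' n f) ?_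
  have h := sSup_image_congr_subst_le (φ := φ) h1 (γ := γ') (γ' := γ) hγγ' hφ n (f.subst γ)
  rwa [← subst_mul, hγ'γ, subst_one] at h

/-- A unit-determinant integral matrix `γ` of `GL₂(ℤ)`, mapped to `M₂(ℤ_p)`, and its inverse are
mutually inverse and both have `det² = 1`. [folklore] -/
theorem map_intCast_mul_inv_and_det {γ : Matrix (Fin 2) (Fin 2) ℤ} (hγ : IsUnit γ.det) :
    γ.map (Int.castRingHom ℤ_[p]) * γ⁻¹.map (Int.castRingHom ℤ_[p]) = 1 ∧
      γ⁻¹.map (Int.castRingHom ℤ_[p]) * γ.map (Int.castRingHom ℤ_[p]) = 1 ∧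
      (γ.map (Int.castRingHom ℤ_[p])).det * (γ.map (Int.castRingHom ℤ_[p])).det = 1 ∧
      (γ⁻¹.map (Int.castRingHom ℤ_[p])).det * (γ⁻¹.map (Int.castRingHom ℤ_[p])).det = 1 := by
  have hsq : ∀ δ : Matrix (Fin 2) (Fin 2) ℤ, IsUnit δ.det →
      (δ.map (Int.castRingHom ℤ_[p])).det * (δ.map (Int.castRingHom ℤ_[p])).det = 1 := by
    intro δ hδ
    have hd : (δ.map (Int.castRingHom ℤ_[p])).det = (δ.det : ℤ_[p]) := by
      rw [← RingHom.mapMatrix_apply, ← RingHom.map_det, eq_intCast]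
    rw [hd, ← Int.cast_mul]
    rcases Int.isUnit_iff.mp hδ with h | h <;> rw [h] <;> norm_num
  have hmul : ∀ δ δ' : Matrix (Fin 2) (Fin 2) ℤ, δ * δ' = 1 →
      δ.map (Int.castRingHom ℤ_[p]) * δ'.map (Int.castRingHom ℤ_[p]) = 1 := by
    intro δ δ' h
    rw [← RingHom.mapMatrix_apply, ← RingHom.mapMatrix_apply, ← map_mul, h, map_one]
  refine ⟨hmul _ _ (Matrix.mul_nonsing_inv γ hγ), hmul _ _ (Matrix.nonsing_inv_mul γ hγ), hsq γ hγ,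
    hsq γ⁻¹ (Matrix.isUnit_nonsing_inv_det_iff.mpr hγ)⟩

/-! ## §2 The local sieve weight `φ_p = 1_{ℚ_p-soluble} · 1_{2⁴F_p^{inv} × 2⁶F_p^{inv}} / m_p` -/

/-- `F_p^{inv}` is stable under `(I, J) ↦ (u⁴I, u⁶J)` for a unit `u` of `ℤ_p` (divisibility by
powers of `p` is unchanged by units). [folklore] -/
theorem mem_invariantPairsAdic_unit_smul {u : ℤ_[p]} (hu : IsUnit u) {IJ : ℤ_[p] × ℤ_[p]}
    (h : IJ ∈ invariantPairsAdic p) : (u ^ 4 * IJ.1, u ^ 6 * IJ.2) ∈ invariantPairsAdic p := by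
  rw [mem_invariantPairsAdic_iff] at h ⊢
  obtain ⟨AB, hAB, rfl⟩ := h
  refine ⟨(u ^ 4 * AB.1, u ^ 6 * AB.2), ?_, Prod.ext (by simp only; ring) (by simp only; ring)⟩
  rw [mem_minimalPairsAdic_iff] at hAB ⊢
  rintro ⟨h4, h6⟩
  exact hAB ⟨(hu.pow 4).dvd_mul_left.mp h4, (hu.pow 6).dvd_mul_left.mp h6⟩

/-- **`φ_p` is invariant under substitutions `δ ∈ M₂(ℤ_p)` with `det(δ)² = 1`** (in particular
under `GL₂(ℤ)`): `ℚ_p`-solubility is (`isSoluble_subst_iff`), the invariants are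
(`I(f∘δ) = det⁴ I(f) = I(f)`, `J(f∘δ) = det⁶ J(f) = J(f)`), and `m_p(f∘δ) = m_p(f)` because
`f ∘ δ` is the twisted action of `δ` on `f` when `det² = 1` and `m_p` is a class function
(`weight_smul`). [cite: BhargavaShankarAnnals2015, §3.2 (m_p is PGL₂(ℚ_p)-invariant) and proof of Thm 3.19 (published numbering)] -/
theorem sievePhi_subst_eq (δ : Matrix (Fin 2) (Fin 2) ℤ_[p]) (hδ : δ.det * δ.det = 1)
    (f : BinaryQuartic ℤ_[p]) :
    (if ((f.subst δ).map PadicInt.Coe.ringHom).IsSoluble ∧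
          (∃ IJ ∈ invariantPairsAdic p, (f.subst δ).I = 2 ^ 4 * IJ.1 ∧ (f.subst δ).J = 2 ^ 6 * IJ.2)
        then (1 : ℝ) / localWeight (f.subst δ) else 0) =
      (if (f.map PadicInt.Coe.ringHom).IsSoluble ∧
          (∃ IJ ∈ invariantPairsAdic p, f.I = 2 ^ 4 * IJ.1 ∧ f.J = 2 ^ 6 * IJ.2)
        then (1 : ℝ) / localWeight f else 0) := by
  have hunit : IsUnit δ.det := IsUnit.of_mul_eq_one _ hδ
  have hdetK : (δ.map (PadicInt.Coe.ringHom (p := p))).det ≠ 0 := by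
    rw [← RingHom.mapMatrix_apply, ← RingHom.map_det]
    exact (hunit.map _).ne_zero
  -- solubility
  have hsol : ((f.subst δ).map PadicInt.Coe.ringHom).IsSoluble ↔ (f.map PadicInt.Coe.ringHom).IsSoluble := by
    rw [map_subst]
    exact isSoluble_subst_iff _ hdetK
  -- invariants
  have hd4 : δ.det ^ 4 = 1 := by
    calc δ.det ^ 4 = (δ.det * δ.det) ^ 2 := by ring
      _ = 1 := by rw [hδ, one_pow]
  have hd6 : δ.det ^ 6 = 1 := by
    calc δ.det ^ 6 = (δ.det * δ.det) ^ 3 := by ring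
      _ = 1 := by rw [hδ, one_pow]
  have hI : (f.subst δ).I = f.I := by rw [I_subst, hd4, one_mul]
  have hJ : (f.subst δ).J = f.J := by rw [J_subst, hd6, one_mul]
  -- the weight
  have hw : localWeight (f.subst δ) = localWeight f := by
    have htw : (f.subst δ).map (PadicInt.Coe.ringHom (p := p)) =
        twist (δ.map PadicInt.Coe.ringHom) (f.map PadicInt.Coe.ringHom) := by
      rw [twist_map_map_eq (PadicInt.Coe.ringHom (p := p)) hδ f]
      congr 1
      rw [show δ.det ^ 2 = 1 by rw [sq, hδ], one_smul]
    let G : GL (Fin 2) ℚ_[p] := Matrix.GeneralLinearGroup.mkOfDetNeZero _ hdetK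
    have hG : twist (δ.map PadicInt.Coe.ringHom) (f.map PadicInt.Coe.ringHom) =
        G • f.map PadicInt.Coe.ringHom := by
      rw [gl_smul_def]
      rfl
    unfold localWeight
    rw [htw, hG, weight_smul]
  simp only [hsol, hI, hJ, hw]

/-- **Acceptability of `φ_p`**: almost every `f ∈ V_{ℤ_p}` (namely every `f` with `Δ(f) ≠ 0`) has a
neighbourhood on which `φ_p` is constant. [cite: BhargavaShankarAnnals2015, §2.7 (acceptable functions) and proof of Thm 3.19 (published numbering)] -/
theorem ae_eventually_sievePhi_eq :
    ∀ᵐ f : BinaryQuartic ℤ_[p] ∂volume, ∀ᶠ f' in 𝓝 f,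
      (if (f'.map PadicInt.Coe.ringHom).IsSoluble ∧
            (∃ IJ ∈ invariantPairsAdic p, f'.I = 2 ^ 4 * IJ.1 ∧ f'.J = 2 ^ 6 * IJ.2)
          then (1 : ℝ) / localWeight f' else 0) =
        (if (f.map PadicInt.Coe.ringHom).IsSoluble ∧
            (∃ IJ ∈ invariantPairsAdic p, f.I = 2 ^ 4 * IJ.1 ∧ f.J = 2 ^ 6 * IJ.2)
          then (1 : ℝ) / localWeight f else 0) := by
  filter_upwards [ae_disc_ne_zero (R := ℤ_[p])] with f hf using eventually_sievePhi_eq p f hf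

variable (p)

/-- **`∫ ψ'_{p,n} dμ_p → ∫ φ_p dμ_p`** as the level `n → ∞`, for the upper envelopes
`ψ'_{p,n}(f) = sup_{g ≡ f (pⁿ)} φ_p(g)` of the local sieve weight (dominated convergence; display
(26) of the source). [cite: BhargavaShankarAnnals2015, §2.7, proof of Thm 2.21, eq. (26) (published numbering)] -/
theorem tendsto_integral_sSup_sievePhi :
    Tendsto (fun n : ℕ => ∫ f : BinaryQuartic ℤ_[p],
        sSup ((fun g : BinaryQuartic ℤ_[p] =>
          (if (g.map PadicInt.Coe.ringHom).IsSoluble ∧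
                (∃ IJ ∈ invariantPairsAdic p, g.I = 2 ^ 4 * IJ.1 ∧ g.J = 2 ^ 6 * IJ.2)
              then (1 : ℝ) / localWeight g else 0)) ''
          {g : BinaryQuartic ℤ_[p] | ∀ i, (p : ℤ_[p]) ^ n ∣ g.coeffs i - f.coeffs i}))
      atTop
      (𝓝 (∫ f : BinaryQuartic ℤ_[p],
        (if (f.map PadicInt.Coe.ringHom).IsSoluble ∧
              (∃ IJ ∈ invariantPairsAdic p, f.I = 2 ^ 4 * IJ.1 ∧ f.J = 2 ^ 6 * IJ.2)
            then (1 : ℝ) / localWeight f else 0))) :=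
  tendsto_integral_sSup_image_congr (fun f => (sievePhi_nonneg_le_one p f).1)
    (fun f => (sievePhi_nonneg_le_one p f).2) ae_eventually_sievePhi_eq

variable {p}

/-- **`φ_p(f ⊗ ℤ_p) = 1/m_p(f)` on the forms counted in `N(S^F; ·)`**: if `f ∈ V_ℤ` is locally
soluble with the invariants `I = 2⁴(−3A)`, `J = 2⁶(−27B)` of a curve `E_{A,B}` of the family
(`IsInHeightFamily (A, B)`), then `f ⊗ ℤ_p` is `ℚ_p`-soluble with invariants in
`2⁴F_p^{inv} × 2⁶F_p^{inv}`. [cite: BhargavaShankarAnnals2015, proof of Thm 3.19 (S_p(F); published numbering)] -/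
theorem sievePhi_map_intCast_eq {AB : ℤ × ℤ} (hAB : IsInHeightFamily AB) {f : BinaryQuartic ℤ}
    (hls : f.IsLocallySoluble) (hI : f.I = 2 ^ 4 * (-3 * AB.1)) (hJ : f.J = 2 ^ 6 * (-27 * AB.2)) :
    (if ((f.map (Int.castRingHom ℤ_[p])).map PadicInt.Coe.ringHom).IsSoluble ∧
          (∃ IJ ∈ invariantPairsAdic p, (f.map (Int.castRingHom ℤ_[p])).I = 2 ^ 4 * IJ.1 ∧
            (f.map (Int.castRingHom ℤ_[p])).J = 2 ^ 6 * IJ.2)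
        then (1 : ℝ) / localWeight (f.map (Int.castRingHom ℤ_[p])) else 0) =
      1 / localWeight (f.map (Int.castRingHom ℤ_[p])) := by
  rw [if_pos]
  refine ⟨?_, ?_⟩
  · rw [map_intCast_map_coe]
    exact hls.2 p
  · refine ⟨(((-3 * AB.1 : ℤ) : ℤ_[p]), ((-27 * AB.2 : ℤ) : ℤ_[p])), ?_, ?_, ?_⟩
    · exact image_invariantPairs_subset_invariantPairsAdic p
        ⟨(-3 * AB.1, -27 * AB.2), ⟨AB, hAB, rfl⟩, rfl⟩
    · rw [I_map, hI, eq_intCast]; push_cast; ring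
    · rw [J_map, hJ, eq_intCast]; push_cast; ring

end Local

/-! ## §3 The product weight over finitely many primes and its density -/

section Product

variable {ι : Type*} [Fintype ι] (q : ι → ℕ) [hq : ∀ i, Fact (q i).Prime] (n : ℕ)

/-- A class function `E` on `V_{ℤ_p}` (constant on congruence classes modulo `pⁿ`) is represented
on residues by `G(s) = E(s̃)`, `s̃` the form with coefficients the standard lifts of `s`:
`G(f mod pⁿ) = E(f)`. [folklore] -/
theorem classFn_eq_comp_toZModPow {p : ℕ} [Fact p.Prime] {n : ℕ} (E : BinaryQuartic ℤ_[p] → ℝ)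
    (hE : ∀ f g : BinaryQuartic ℤ_[p], (∀ j, (p : ℤ_[p]) ^ n ∣ g.coeffs j - f.coeffs j) → E g = E f)
    (f : BinaryQuartic ℤ_[p]) :
    E (equivFin5.symm fun j => ((((PadicInt.toZModPow n (f.coeffs j)).val : ℕ) : ℤ_[p]))) = E f := by
  refine hE _ _ ?_
  rw [forall_pow_dvd_sub_iff_toZModPow_eq, toZModPow_coeffs_symm_val]

/-- **The product weight on `V_ℤ` is the pull-back of `Ψ(r) = ∏_i G_i(r mod q_i^n)`**: if `G_i`
represents `E_i` on residues (`G_i(g mod q_iⁿ) = E_i(g)`), then for every integral `f`,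
`∏_i E_i(f ⊗ ℤ_{q_i}) = ∏_i G_i((f mod N) mod q_i^n)`, `N = ∏_i q_i^n`.
[cite: BhargavaShankarAnnals2015, §2.7, proof of Thm 2.21 (ψ'^Y defined by congruences modulo ∏ p^n; published numbering)] -/
theorem prod_classFn_map_intCast_eq [NeZero (∏ i, q i ^ n)] (E : ∀ i, BinaryQuartic ℤ_[q i] → ℝ)
    (G : ∀ i, (Fin 5 → ZMod (q i ^ n)) → ℝ)
    (hGE : ∀ i (g : BinaryQuartic ℤ_[q i]), G i (fun j => PadicInt.toZModPow n (g.coeffs j)) = E i g)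
    (f : BinaryQuartic ℤ) :
    ∏ i, E i (f.map (Int.castRingHom ℤ_[q i])) =
      ∏ i, G i (fun j => ZMod.castHom (Finset.dvd_prod_of_mem (fun i => q i ^ n) (Finset.mem_univ i))
        (ZMod (q i ^ n)) ((f.coeffs j : ℤ) : ZMod (∏ i, q i ^ n))) := by
  rw [← prod_weight_map_intCast_eq q (fun _ => n) G f]
  exact Finset.prod_congr rfl fun i _ => (hGE i _).symm

omit hq in
/-- The product weight `Ψ` takes values in `[0,1]` when the `G_i` do. [folklore] -/
theorem prod_comp_castHom_mem_Icc [NeZero (∏ i, q i ^ n)] (G : ∀ i, (Fin 5 → ZMod (q i ^ n)) → ℝ)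
    (hG0 : ∀ i s, 0 ≤ G i s) (hG1 : ∀ i s, G i s ≤ 1) (r : Fin 5 → ZMod (∏ i, q i ^ n)) :
    0 ≤ ∏ i, G i (fun j => ZMod.castHom (Finset.dvd_prod_of_mem (fun i => q i ^ n) (Finset.mem_univ i))
        (ZMod (q i ^ n)) (r j)) ∧
      ∏ i, G i (fun j => ZMod.castHom (Finset.dvd_prod_of_mem (fun i => q i ^ n) (Finset.mem_univ i))
        (ZMod (q i ^ n)) (r j)) ≤ 1 :=
  ⟨Finset.prod_nonneg fun i _ => hG0 i _, Finset.prod_le_one (fun i _ => hG0 i _) fun i _ => hG1 i _⟩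

/-- **`GL₂(ℤ)`-invariance of the product weight**: if each `E_i` is invariant under the
substitutions `δ ∈ M₂(ℤ_{q_i})` with `det(δ)² = 1`, then `∏_i E_i(g ⊗ ℤ_{q_i}) = ∏_i E_i(f ⊗ ℤ_{q_i})`
for `GL₂(ℤ)`-equivalent integral forms `f`, `g`.
[cite: BhargavaShankarAnnals2015, §2.7 (Thm 2.12 for GL₂(ℤ)-invariant weights; published numbering)] -/
theorem prod_classFn_eq_of_gl2zEquiv (E : ∀ i, BinaryQuartic ℤ_[q i] → ℝ)
    (hEinv : ∀ i (δ : Matrix (Fin 2) (Fin 2) ℤ_[q i]), δ.det * δ.det = 1 →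
      ∀ h : BinaryQuartic ℤ_[q i], E i (h.subst δ) = E i h)
    {f g : BinaryQuartic ℤ} (hfg : GL2ZEquiv f g) :
    ∏ i, E i (g.map (Int.castRingHom ℤ_[q i])) = ∏ i, E i (f.map (Int.castRingHom ℤ_[q i])) := by
  obtain ⟨γ, hγ, rfl⟩ := hfg
  refine Finset.prod_congr rfl fun i _ => ?_
  rw [map_subst]
  exact hEinv i _ (map_intCast_mul_inv_and_det (p := q i) hγ).2.2.1 _

/-- **The density of the product weight is the product of the local integrals**:
`N⁻⁵ Σ_{r ∈ (ℤ/Nℤ)⁵} ∏_i G_i(r mod q_i^n) = ∏_i ∫_{V_{ℤ_{q_i}}} E_i dμ` for distinct primes `q_i`,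
`N = ∏ q_i^n`, `G_i` representing the class functions `E_i` — "`= lim N(V;X)/X^{5/6} · ∏_{p<Y} ∫ψ'_{p}`".
[cite: BhargavaShankarAnnals2015, §2.5 proof of Thm 2.11 (k·m⁻⁵ = ∏ μ_p) and §2.7 proof of Thm 2.21 (published numbering)] -/
theorem density_prod_classFn_eq_prod_integral [NeZero (∏ i, q i ^ n)] (hinj : Function.Injective q)
    (E : ∀ i, BinaryQuartic ℤ_[q i] → ℝ) (G : ∀ i, (Fin 5 → ZMod (q i ^ n)) → ℝ)
    (hGE : ∀ i (g : BinaryQuartic ℤ_[q i]), G i (fun j => PadicInt.toZModPow n (g.coeffs j)) = E i g) :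
    (∑ r : Fin 5 → ZMod (∏ i, q i ^ n),
        ∏ i, G i (fun j => ZMod.castHom (Finset.dvd_prod_of_mem (fun i => q i ^ n) (Finset.mem_univ i))
          (ZMod (q i ^ n)) (r j))) / ((∏ i, q i ^ n : ℕ) : ℝ) ^ 5 =
      ∏ i, ∫ g : BinaryQuartic ℤ_[q i], E i g := by
  haveI : ∀ i, NeZero (q i ^ n) := fun i => ⟨pow_ne_zero _ (hq i).out.ne_zero⟩
  have hcop := pairwise_coprime_pow_of_injective q (fun i => (hq i).out) hinj fun _ => n
  rw [density_prod_comp_castHom_eq_prod_density (fun i => q i ^ n) hcop G]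
  refine Finset.prod_congr rfl fun i _ => ?_
  have hint := integral_comp_coeffs_toZModPow_eq (q i) n (G i)
  simp_rw [hGE i] at hint
  rw [hint, div_eq_inv_mul]
  congr 2
  push_cast
  ring

/-- Pointwise domination `∏_i φ_i ≤ ∏_i E_i` for weights `0 ≤ φ_i ≤ E_i` (here `φ_p ≤ ψ'_{p,n}`,
so that `N_φ ≤ N_{ψ'}`). [cite: BhargavaShankarAnnals2015, §2.7, proof of Thm 2.21 ("φ ≤ ψ'"; published numbering)] -/
theorem prod_le_prod_classFn (φ E : ∀ i, BinaryQuartic ℤ_[q i] → ℝ) (h0 : ∀ i g, 0 ≤ φ i g)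
    (hle : ∀ i g, φ i g ≤ E i g) (f : BinaryQuartic ℤ) :
    ∏ i, φ i (f.map (Int.castRingHom ℤ_[q i])) ≤ ∏ i, E i (f.map (Int.castRingHom ℤ_[q i])) :=
  Finset.prod_le_prod (fun i _ => h0 i _) fun i _ => hle i _

end Product

/-! ## §4 The exchange of limits for the upper bound -/

/-- **Choosing the primes and the level.** If `b_i(n) → a_i` for every `i` and the product of the
`a_i` converges (unconditionally) to `A`, then for every `δ > 0` there are a finite set `s` and a
level `n` with `∏_{i ∈ s} b_i(n) ≤ A + δ` — with `b_p(n) = ∫ψ'_{p,n}`, `a_p = ∫φ_p` this is the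
passage "letting `Y` tend to infinity" in the upper bound of the proof of Thm 2.21.
[cite: BhargavaShankarAnnals2015, §2.7, proof of Thm 2.21 (upper bound, Y → ∞; published numbering)] -/
theorem exists_finset_prod_le_tprod_add {κ : Type*} {a : κ → ℝ} {A : ℝ} (hA : HasProd a A)
    {b : κ → ℕ → ℝ} (hb : ∀ i, Tendsto (b i) atTop (𝓝 (a i))) {δ : ℝ} (hδ : 0 < δ) :
    ∃ (s : Finset κ) (n : ℕ), ∏ i ∈ s, b i n ≤ A + δ := by
  have h1 : ∀ᶠ s : Finset κ in atTop, ∏ i ∈ s, a i < A + δ / 2 :=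
    hA.eventually (gt_mem_nhds (by linarith))
  obtain ⟨s, hs⟩ := h1.exists
  have h2 : Tendsto (fun n => ∏ i ∈ s, b i n) atTop (𝓝 (∏ i ∈ s, a i)) :=
    tendsto_finsetProd s fun i _ => hb i
  have h3 : ∀ᶠ n in atTop, ∏ i ∈ s, b i n < ∏ i ∈ s, a i + δ / 2 :=
    h2.eventually (gt_mem_nhds (by linarith))
  obtain ⟨n, hn⟩ := h3.exists
  exact ⟨s, n, by linarith⟩

end BinaryQuartic

end Literature.NumberTheory.EllipticCurves

end
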